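import Literature.ComputerArithmetic.FloatingPoint.MiniFloat

/-!
# Double rounding of products at a finer register quantum: the two-grid window as a table

HONEST FRAMING (venture CertifiedArithmetic / cell `pub-lowprec`): certified error envelopes and
provably optimal rounding/accumulation schemes for low-precision formats under stated cost models;
every table by two implementations; no hardware or vendor claims.

The integer side (implementation B) of the positive law for `DRMul` on the FINE STRIP
`P < P_ψ ≤ 2P - 1` at a register quantum `q_ψ = q / 2^d`, `d ≥ m + 2`
(`DoubleRoundingProductStripFineLaw.lean`).  Setting: target `φ` (`m = m_φ ≥ 1`, `P = m + 1`),
register `ψ` (`m + 1 ≤ m_ψ ≤ 2m`).  A product of `φ`-data is `K·2^E·q`, `K = oa·ob` the product of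
the odd parts, `2^G ≤ K < 2^(G+1)` (`G < 2P`).  Under `d ≥ m + 2` a slipping product lies in one of
three zones (`DoubleRoundingProductStripFineZones.lean`), and in each the two-grid window is a condition
on `K` alone: FAR (a normal cell of `φ` where the register spacing is `≥ 2 q_ψ`; `t = G - m`
extra bits, half-grid `2^g`, `g = G - m_ψ - 1`, the tie counts iff `δ = m_ψ - m ≥ 2` — as at
`d = 0`); LOW (the cell `[c, c+1]·q`, `c = ⌊K/2^u⌋ ≥ 1`, `G - m ≤ u ≤ G`; register grid `2^w q_ψ`,
`w = (G - u + d) ∸ m_ψ`, `g = w + u - d - 1 ≥ 0`, tie iff `w + 2 ≤ d`); BOTTOM (the cell `[0, q]`,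
`u = G + 1`; `g = u - 2 - min m_ψ (d-1) ≥ 0`, the tie always counts, `c = 0` is even).  The test
`mulFineHitAt P m_ψ d oa ob` and the table `mulFineHit P m_ψ d` (§1); beyond `d = 2m + 1` nothing
changes (the law clamps `d` there).  Kernel table (§1): on the fine strip with `d ≥ m + 2` the only
hit-free register of a `P ≤ 4` format is `(P, P_ψ) = (3, 5)` (`d ≥ 4`); `(2,3)` is hit by `3 × 3`
(bottom, the family (W9) of `DoubleRoundingProductStripFine.lean`), `(3,4)` by `3 × 7` (low, the
family (W21)), `(4, 5…7)` at every `d` (cf. `not_drMul_strip`).  §2: from the window disjunctions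
to hits.
Two implementations: A = `code/enum/mul_strip_fine_table.py` (literal transcription incl.
truncated subtraction; cross-checked against brute force on pseudo-records: no hit ⟹ no slip on
every embedded row, every hit cell realised by a slip on a deep row) →
`certs/enum/DOUBLE-ROUNDING-MUL-STRIP-FINE-TABLE.json`; B = this file.
PLACEMENT — KNOWN: slips only through midpoints of the target ([MartinDorelMelquiondMuller2013,
Property 2.1]; [Figueroa1995, §2–3]); with unbounded exponents no counterexample exists for
`p₁ ≤ 3` ([Rump2016, Lemma 4.5, proof]), so every hit here is a gradual-underflow cell.  NEW
(modestly): the decidable window at a finer register quantum.  No hardware or vendor claims.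
-/

namespace Summit.Ventures.CertifiedArithmetic

/-! ## §1 The two-grid window in integers -/

/-- THE WINDOW TEST at `K = c·2^t + r` (any `c ≥ 0`), half-grid `2^g` of the register in units of
the last bit of `K`, `tie` = whether the boundary counts:
`(c even ∧ 2^(t-1) < r ∧ (r < 2^(t-1) + 2^g ∨ (tie ∧ r = 2^(t-1) + 2^g))) ∨
 (c odd ∧ r < 2^(t-1) ∧ (2^(t-1) < r + 2^g ∨ (tie ∧ r + 2^g = 2^(t-1))))`. [this packet] -/
def mulFineWinAt (t g : ℕ) (tie : Bool) (K : ℕ) : Bool :=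
  let c := K / 2 ^ t
  let r := K % 2 ^ t
  (c % 2 == 0 && decide (2 ^ (t - 1) < r) &&
      (decide (r < 2 ^ (t - 1) + 2 ^ g) || (tie && r == 2 ^ (t - 1) + 2 ^ g))) ||
    (c % 2 == 1 && decide (r < 2 ^ (t - 1)) &&
      (decide (2 ^ (t - 1) < r + 2 ^ g) || (tie && r + 2 ^ g == 2 ^ (t - 1))))

/-- THE HIT TEST at one odd pair (`P` = source precision, `mψ` = register trailing bits, `d` =
quantum gap), `K = oa·ob`, `2^G ≤ K < 2^(G+1)` (`G < 2P`): FAR (`m_ψ + 1 ≤ G`; `t = G - m`,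
`g = G - m_ψ - 1`, tie iff `P + 1 ≤ m_ψ`) ∨ LOW (`u = i + 1 ≤ G`, `G ≤ m + u`;
`w = (G - u + d) ∸ m_ψ`, needs `d + 1 ≤ w + u`; `g = w + u - d - 1`, tie iff `w + 2 ≤ d`) ∨ BOTTOM
(`u = G + 1`; needs `2 + min m_ψ (d-1) ≤ u`; `g = u - 2 - min m_ψ (d-1)`, tie always).
[this packet] -/
def mulFineHitAt (P mψ d oa ob : ℕ) : Bool :=
  let K := oa * ob
  (List.range (2 * P)).any fun G =>
    decide (2 ^ G ≤ K) && decide (K < 2 ^ (G + 1)) &&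
    ((decide (mψ + 1 ≤ G) &&
        mulFineWinAt (G - (P - 1)) (G - mψ - 1) (decide (P + 1 ≤ mψ)) K) ||
      ((List.range G).any fun i =>
        decide (G ≤ P - 1 + (i + 1)) && decide (d + 1 ≤ (G - (i + 1) + d - mψ) + (i + 1)) &&
          mulFineWinAt (i + 1) ((G - (i + 1) + d - mψ) + (i + 1) - d - 1)
            (decide ((G - (i + 1) + d - mψ) + 2 ≤ d)) K) ||
      (decide (2 + min mψ (d - 1) ≤ G + 1) &&
        mulFineWinAt (G + 1) (G + 1 - 2 - min mψ (d - 1)) true K))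

/-- `hit(P, m_ψ, d)`: some odd `oa, ob < 2^P` pass the hit test. [this packet] -/
def mulFineHit (P mψ d : ℕ) : Bool :=
  (List.range (2 ^ (P - 1))).any fun j =>
    (List.range (2 ^ (P - 1))).any fun l => mulFineHitAt P mψ d (2 * j + 1) (2 * l + 1)

/-- Implementation B of the table on the fine strip `P ≤ m_ψ ≤ 2P - 2` at the clamped gaps
`P + 1 ≤ d ≤ 2P - 1`, `P = 2, 3, 4` (kernel): the only hit-free register is `(P, m_ψ) = (3, 4)`
(`P_ψ = 5`); implementation A: hit cells `3 × 3` (bottom) for `(2, 2)`, `3 × 7`, `7 × 3` (low,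
`u = 3`) for `(3, 3)`, and `16, 16, 16 / 14, 12, 12 / 5, 3, 1` cells `(oa, ob)` for `(4, 4 / 5 / 6)`
at `d = 5, 6, 7`. [this packet] -/
theorem mulFineHit_table :
    [2, 3, 4].map (fun P => (List.range (P - 1)).map fun j =>
      (List.range (P - 1)).map fun i => mulFineHit P (P + j) (P + 1 + i))
      = [[[true]], [[true, true], [false, false]],
          [[true, true, true], [true, true, true], [true, true, true]]] := by
  decide +kernel

/-- NO HIT for `(P, m_ψ) = (3, 4)` at every clamped gap `min d 5`, `d ≥ 4`. [this packet] -/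
theorem mulFineHit_three_four (d : ℕ) (hd : 4 ≤ d) : mulFineHit 3 4 (min d 5) = false := by
  have h : ∀ e < 6, 4 ≤ e → mulFineHit 3 4 e = false := by decide +kernel
  exact h (min d 5) (by omega) (by omega)

/-! ## §2 From the window disjunctions to a hit -/

/-- The window disjunction at `K = c·2^t + r` with the tie flag a decidable proposition `T` is a
hit of `mulFineWinAt t g (decide T) K`. [this packet] -/
theorem mulFineWinAt_of_window {t g K c r : ℕ} {T : Prop} [Decidable T]
    (hK : K = c * 2 ^ t + r) (hr : r < 2 ^ t)
    (hw : (c % 2 = 0 ∧ 2 ^ (t - 1) < r ∧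
        (r < 2 ^ (t - 1) + 2 ^ g ∨ (T ∧ r = 2 ^ (t - 1) + 2 ^ g))) ∨
      (c % 2 = 1 ∧ r < 2 ^ (t - 1) ∧
        (2 ^ (t - 1) < r + 2 ^ g ∨ (T ∧ r + 2 ^ g = 2 ^ (t - 1))))) :
    mulFineWinAt t g (decide T) K = true := by
  obtain ⟨hc, hr'⟩ := (Nat.div_mod_unique (a := K) (b := 2 ^ t) (c := r) (d := c)
    (by positivity)).mpr ⟨by rw [hK]; ring, hr⟩
  simp only [mulFineWinAt]
  rw [hc, hr']
  by_cases hT : T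
  · simp only [hT, true_and, decide_true, Bool.or_eq_true, Bool.and_eq_true, beq_iff_eq,
      decide_eq_true_eq] at hw ⊢
    omega
  · simp only [hT, false_and, or_false, decide_false, Bool.false_and, Bool.or_false,
      Bool.or_eq_true, Bool.and_eq_true, beq_iff_eq, decide_eq_true_eq] at hw ⊢
    omega

/-- A hit of the test at odd `oa, ob < 2^P` is a hit of the table. [this packet] -/
theorem mulFineHit_of_hitAt {P mψ d oa ob : ℕ} (hoa : oa % 2 = 1) (hoa' : oa < 2 ^ P)
    (hob : ob % 2 = 1) (hob' : ob < 2 ^ P) (h : mulFineHitAt P mψ d oa ob = true) :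
    mulFineHit P mψ d = true := by
  have hP : 2 ^ P = 2 * 2 ^ (P - 1) := by
    rcases P with _ | P
    · simp at hoa'; omega
    · rw [pow_succ']; rfl
  unfold mulFineHit
  simp only [List.any_eq_true, List.mem_range]
  refine ⟨oa / 2, by omega, ob / 2, by omega, ?_⟩
  rwa [show 2 * (oa / 2) + 1 = oa by omega, show 2 * (ob / 2) + 1 = ob by omega]

/-- FAR: a window on a normal cell with register spacing `≥ 2 q_ψ` (`m_ψ + 1 ≤ G < 2P`) is a
hit. [this packet] -/
theorem mulFineHit_of_far {P mψ d oa ob G : ℕ} (hoa : oa % 2 = 1) (hoa' : oa < 2 ^ P)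
    (hob : ob % 2 = 1) (hob' : ob < 2 ^ P) (hGP : G < 2 * P) (hGle : 2 ^ G ≤ oa * ob)
    (hGlt : oa * ob < 2 ^ (G + 1)) (hGm : mψ + 1 ≤ G)
    (h : mulFineWinAt (G - (P - 1)) (G - mψ - 1) (decide (P + 1 ≤ mψ)) (oa * ob) = true) :
    mulFineHit P mψ d = true := by
  refine mulFineHit_of_hitAt hoa hoa' hob hob' ?_
  unfold mulFineHitAt
  simp only [Bool.or_eq_true, Bool.and_eq_true, decide_eq_true_eq, List.any_eq_true,
    List.mem_range]
  exact ⟨G, hGP, ⟨hGle, hGlt⟩, Or.inl (Or.inl ⟨hGm, h⟩)⟩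

/-- LOW: a window on a cell `[c, c+1]·q` (`1 ≤ u ≤ G`, `G ≤ m + u`, `w = (G - u + d) ∸ m_ψ`,
`d + 1 ≤ w + u`) is a hit. [this packet] -/
theorem mulFineHit_of_low {P mψ d oa ob G u w : ℕ} (hoa : oa % 2 = 1) (hoa' : oa < 2 ^ P)
    (hob : ob % 2 = 1) (hob' : ob < 2 ^ P) (hGP : G < 2 * P) (hGle : 2 ^ G ≤ oa * ob)
    (hGlt : oa * ob < 2 ^ (G + 1)) (hu1 : 1 ≤ u) (huG : u ≤ G) (hGu : G ≤ P - 1 + u)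
    (hwd : G - u + d - mψ = w) (hgu : d + 1 ≤ w + u)
    (h : mulFineWinAt u (w + u - d - 1) (decide (w + 2 ≤ d)) (oa * ob) = true) :
    mulFineHit P mψ d = true := by
  refine mulFineHit_of_hitAt hoa hoa' hob hob' ?_
  unfold mulFineHitAt
  simp only [Bool.or_eq_true, Bool.and_eq_true, decide_eq_true_eq, List.any_eq_true,
    List.mem_range]
  refine ⟨G, hGP, ⟨hGle, hGlt⟩, Or.inl (Or.inr ⟨u - 1, by omega, ?_⟩)⟩
  rw [Nat.sub_add_cancel hu1, hwd]
  exact ⟨⟨hGu, hgu⟩, h⟩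

/-- BOTTOM: a window on the cell `[0, q]` (`u = G + 1`, `2 + min m_ψ (d-1) ≤ u`) is a hit.
[this packet] -/
theorem mulFineHit_of_bottom {P mψ d oa ob G : ℕ} (hoa : oa % 2 = 1) (hoa' : oa < 2 ^ P)
    (hob : ob % 2 = 1) (hob' : ob < 2 ^ P) (hGP : G < 2 * P) (hGle : 2 ^ G ≤ oa * ob)
    (hGlt : oa * ob < 2 ^ (G + 1)) (hmin : 2 + min mψ (d - 1) ≤ G + 1)
    (h : mulFineWinAt (G + 1) (G + 1 - 2 - min mψ (d - 1)) true (oa * ob) = true) :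
    mulFineHit P mψ d = true := by
  refine mulFineHit_of_hitAt hoa hoa' hob hob' ?_
  unfold mulFineHitAt
  simp only [Bool.or_eq_true, Bool.and_eq_true, decide_eq_true_eq, List.any_eq_true,
    List.mem_range]
  exact ⟨G, hGP, ⟨hGle, hGlt⟩, Or.inr ⟨hmin, h⟩⟩

end Summit.Ventures.CertifiedArithmetic
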